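import Summits.NavierStokesRegularity.NavierStokesRegularity.Theorems.AdaptedFrequencyTangentFlowTransferKernelLimit
import Summits.NavierStokesRegularity.NavierStokesRegularity.Theorems.AdaptedFrequencyTangentFlowTransferKernelExtract
import Literature.Analysis.FluidPDE.TypeIAncientMild
import HarnessLib

/-!
# Kernel stability: hypothesis (B) of `TangentFlowTransfer` proved
# (route `AdaptedFrequency`, item `TangentFlowTransfer`, stmt-NavierStokesRegularity-10494)

Helper file (all results proved). Last step of the proof of hypothesis (B) (kernel stability) of
`tangentFlowTransfer_of_hyp`: identification of the pointwise limit `Glim` of the extracted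
kernels with its smooth representatives on the slabs `(a, 0) × ℝ³`, EVERYWHERE
(`pointwiseLimit_eq_representative`): the pairings `t ↦ ∫ψ Glim(t)` are Lipschitz (limits of
uniformly Lipschitz pairings, `kernelLimit_pairing_lipschitz`), the pairings of the smooth
representative are continuous, they agree for a.e. `t` (Fubini), hence for all `t`; a bump
concentrated at a point and the uniform spatial modulus of the kernels then identify the values.
Consequently `Glim` is jointly smooth on `(−∞, 0) × ℝ³` and solves `∂ₜK + W·∇K + ΔK = 0`
classically, which is hypothesis (B) verbatim (`kernelStability`).
-/

noncomputable section

open MeasureTheory Set Function Filter TopologicalSpace Metric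
open scoped Topology ContDiff Laplacian

namespace Summit.NavierStokesRegularity.NavierStokesRegularity.Theorems

open Literature.Analysis Literature.Analysis.FluidPDE
open Summit.NavierStokesRegularity.NavierStokesRegularity.Theorems.AdaptedKernelExists.NashEntropyLastBlock

local notation "ℝ³" => EuclideanSpace ℝ (Fin 3)

section Identify

variable {C₀ : ℝ} {A : ℕ → ℝ} {w : ℕ → ℝ → ℝ³ → ℝ³} {g : ℕ → ℝ → ℝ³ → ℝ} {C₁ C₂ : ℝ}
  {Glim : ℝ → ℝ³ → ℝ}

/-- The limit slices are continuous (the uniform spatial modulus passes to the limit). [folklore] -/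
theorem continuous_pointwiseLimit_slice
    (hgK : ∀ t < 0, ∀ x, Tendsto (fun k => g k t x) atTop (𝓝 (Glim t x)))
    (hmod : ∀ t < 0, ∀ x, ∀ ε : ℝ, 0 < ε → ∃ δ : ℝ, 0 < δ ∧
      ∀ᶠ j in atTop, ∀ y : ℝ³, ‖y - x‖ ≤ δ → |g j t y - g j t x| ≤ ε) {t : ℝ} (ht : t < 0) :
    Continuous (Glim t) := by
  rw [continuous_iff_continuousAt]
  intro x
  rw [Metric.continuousAt_iff]
  intro ε hε
  obtain ⟨δ, hδ, hev⟩ := hmod t ht x (ε / 2) (by positivity)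
  refine ⟨δ, hδ, fun y hy => ?_⟩
  have hlim := ((hgK t ht y).sub (hgK t ht x)).abs
  have hle : |Glim t y - Glim t x| ≤ ε / 2 :=
    le_of_tendsto hlim (hev.mono fun j hj => hj y (by rw [dist_eq_norm] at hy; exact hy.le))
  rw [Real.dist_eq]
  linarith

/-- **Convergence of the pairings** `∫ψ g_k(t) → ∫ψ Glim(t)` for continuous compactly supported
`ψ` (dominated convergence under the Gaussian envelope). [folklore] -/
theorem tendsto_pairing_pointwiseLimit (hA : Tendsto A atTop atBot)
    (hg : ∀ k, IsAdaptedBackwardKernel 1 (w k) (Ico (A k) 0) 0 0 (g k)) (hC₁ : 0 < C₁)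
    (hC₂ : 0 < C₂)
    (hgb : ∀ k, ∀ t ∈ Ico (A k) 0, ∀ x, g k t x ≤ C₁ * ((0:ℝ) - t) ^ (-(3:ℝ) / 2) *
      Real.exp (-(‖x - (0 : ℝ³)‖ ^ 2) / (C₂ * ((0:ℝ) - t))))
    (hgK : ∀ t < 0, ∀ x, Tendsto (fun k => g k t x) atTop (𝓝 (Glim t x)))
    {ψ : ℝ³ → ℝ} (hψ : Continuous ψ) (hψc : HasCompactSupport ψ) {t : ℝ} (ht : t < 0) :
    Tendsto (fun k => ∫ x, ψ x * g k t x) atTop (𝓝 (∫ x, ψ x * Glim t x)) := by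
  obtain ⟨j₀, hj₀⟩ : ∃ j₀ : ℕ, ∀ k ≥ j₀, A k ≤ t :=
    eventually_atTop.1 (hA.eventually (eventually_le_atBot t))
  have htI : ∀ j, t ∈ Ico (A (j + j₀)) 0 := fun j => ⟨hj₀ _ (Nat.le_add_left _ _), ht⟩
  set M : ℝ := C₁ * ((0:ℝ) - t) ^ (-(3:ℝ) / 2) with hM
  have hshift : Tendsto (fun j => ∫ x, ψ x * g (j + j₀) t x) atTop (𝓝 (∫ x, ψ x * Glim t x)) := by
    refine tendsto_integral_of_dominated_convergence (fun x => |ψ x| * M) (fun j => ?_)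
      ((hψ.abs.mul continuous_const).integrable_of_hasCompactSupport (hψc.norm.mul_right))
      (fun j => Eventually.of_forall fun x => ?_) (Eventually.of_forall fun x => ?_)
    · exact (hψ.mul ((hg _).contDiff_slice (htI j)).continuous).aestronglyMeasurable
    · rw [Real.norm_eq_abs, abs_mul, abs_of_pos ((hg _).pos t (htI j) x)]
      exact mul_le_mul_of_nonneg_left
        ((hgb _ t (htI j) x).trans (gaussian_upper_le_const hC₁.le hC₂ le_rfl ht x)) (abs_nonneg _)
    · exact ((hgK t ht x).comp (tendsto_add_atTop_nat j₀)).const_mul _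
  exact (tendsto_add_atTop_iff_nat j₀).1 hshift

/-- **The limit pairings are Lipschitz in time** on compact sub-intervals of `(−∞, 0)`, with the
uniform constant of `kernelLimit_pairing_lipschitz`. [folklore] -/
theorem pairing_pointwiseLimit_lipschitz (hC₀ : 0 ≤ C₀) (hA : Tendsto A atTop atBot)
    (hw : ∀ k, IsSmoothSpaceTimeOn (Ico (A k) 0) (w k))
    (hdiv : ∀ k, ∀ t ∈ Ico (A k) 0, VectorCalculus.IsDivFree (w k t))
    (hI : ∀ k, ∀ t ∈ Ioo (A k) 0, ∀ x, ‖w k t x‖ ≤ C₀ / Real.sqrt (-t))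
    (hg : ∀ k, IsAdaptedBackwardKernel 1 (w k) (Ico (A k) 0) 0 0 (g k)) (hC₁ : 0 < C₁)
    (hC₂ : 0 < C₂)
    (hgb : ∀ k, ∀ t ∈ Ico (A k) 0, ∀ x, g k t x ≤ C₁ * ((0:ℝ) - t) ^ (-(3:ℝ) / 2) *
      Real.exp (-(‖x - (0 : ℝ³)‖ ^ 2) / (C₂ * ((0:ℝ) - t))))
    (hgK : ∀ t < 0, ∀ x, Tendsto (fun k => g k t x) atTop (𝓝 (Glim t x)))
    {ψ : ℝ³ → ℝ} (hψ : ContDiff ℝ ∞ ψ) (hψc : HasCompactSupport ψ) {t₁ t₂ : ℝ} (ht₂ : t₂ < 0) :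
    ∃ L : ℝ, ∀ s ∈ Icc t₁ t₂, ∀ t ∈ Icc t₁ t₂,
      |(∫ x, ψ x * Glim t x) - ∫ x, ψ x * Glim s x| ≤ L * |t - s| := by
  -- bounds of the test function
  have hψ2 : ContDiff ℝ 2 ψ := contDiff_infty.1 hψ 2
  obtain ⟨M₁, hM₁⟩ := (hψc.fderiv (𝕜 := ℝ)).exists_bound_of_continuous
    (hψ2.continuous_fderiv two_ne_zero)
  obtain ⟨M₂', hM₂'⟩ := (hψc.iteratedFDeriv 2).exists_bound_of_continuous
    (hψ2.continuous_iteratedFDeriv le_rfl)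
  have hM₂ : ∀ x, |(Δ ψ) x| ≤ 3 * M₂' := by
    intro x
    have h1 := norm_laplacian_le ψ x
    rw [finrank_euclideanSpace_fin] at h1
    rw [← Real.norm_eq_abs]
    refine h1.trans ?_
    have h2 : ‖fderiv ℝ (fderiv ℝ ψ) x‖ = ‖iteratedFDeriv ℝ 2 ψ x‖ := by
      rw [← norm_iteratedFDeriv_fderiv, norm_iteratedFDeriv_one]
    rw [h2]; push_cast
    exact mul_le_mul_of_nonneg_left (hM₂' x) (by norm_num)
  -- the windows eventually contain `[t₁ - 1, 0)`
  obtain ⟨j₀, hj₀⟩ : ∃ j₀ : ℕ, ∀ k ≥ j₀, A k < t₁ - 1 :=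
    eventually_atTop.1 (hA.eventually (eventually_lt_atBot (t₁ - 1)))
  set Bd : ℝ := C₀ / Real.sqrt ((0:ℝ) - t₂) with hBd
  have hBd0 : 0 ≤ Bd := div_nonneg hC₀ (Real.sqrt_nonneg _)
  refine ⟨Bd * M₁ + 1 * (3 * M₂'), fun s hs t ht => ?_⟩
  -- the uniform estimate for every late kernel
  have hk : ∀ j, |(∫ x, ψ x * g (j + j₀) t x) - ∫ x, ψ x * g (j + j₀) s x| ≤
      (Bd * M₁ + 1 * (3 * M₂')) * |t - s| := by
    intro j
    have hAj : A (j + j₀) < t₁ - 1 := hj₀ _ (Nat.le_add_left _ _)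
    refine kernelLimit_pairing_lipschitz (E := ℝ³) (ν := 1) zero_le_one (hw _) (hdiv _) (hg _)
      hψ2 hψc (t₁ := t₁) (t₂ := t₂) (by linarith) ht₂ hBd0 (fun r hr x _ => ?_) hM₁ hM₂ hs ht
    have hrI : r ∈ Ioo (A (j + j₀)) 0 := ⟨by linarith [hr.1], hr.2.trans_lt ht₂⟩
    refine (hI _ r hrI x).trans ?_
    exact div_le_div_of_nonneg_left hC₀ (Real.sqrt_pos.2 (by linarith))
      (Real.sqrt_le_sqrt (by linarith [hr.2]))
  -- pass to the limit
  have hs0 : s < 0 := hs.2.trans_lt ht₂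
  have ht0 : t < 0 := ht.2.trans_lt ht₂
  have hlim := (((tendsto_pairing_pointwiseLimit hA hg hC₁ hC₂ hgb hgK hψ.continuous hψc ht0).comp
    (tendsto_add_atTop_nat j₀)).sub ((tendsto_pairing_pointwiseLimit hA hg hC₁ hC₂ hgb hgK
    hψ.continuous hψc hs0).comp (tendsto_add_atTop_nat j₀))).abs
  exact le_of_tendsto hlim (Eventually.of_forall hk)

/-- **Continuity in time of the pairings of a jointly continuous field** with a continuous
compactly supported test function, on an open time set. [folklore] -/
theorem continuousOn_pairing_of_continuousOn {S : Set ℝ} (hS : IsOpen S) {K : ℝ → ℝ³ → ℝ}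
    (hK : ContinuousOn (uncurry K) (S ×ˢ univ)) {ψ : ℝ³ → ℝ} (hψ : Continuous ψ)
    (hψc : HasCompactSupport ψ) : ContinuousOn (fun t => ∫ x, ψ x * K t x) S := by
  intro t₀ ht₀
  refine ContinuousAt.continuousWithinAt ?_
  -- a compact time neighbourhood inside `S`
  obtain ⟨ε, hε, hball⟩ := Metric.isOpen_iff.1 hS t₀ ht₀
  have hIcc : Icc (t₀ - ε / 2) (t₀ + ε / 2) ⊆ S := fun r hr =>
    hball (by rw [Metric.mem_ball, Real.dist_eq, abs_lt]; constructor <;> linarith [hr.1, hr.2])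
  have hnhds : Ioo (t₀ - ε / 2) (t₀ + ε / 2) ∈ 𝓝 t₀ := isOpen_Ioo.mem_nhds ⟨by linarith, by linarith⟩
  -- a bound for `K` on the compact block
  obtain ⟨B, hB⟩ := (isCompact_Icc.prod hψc.isCompact).exists_bound_of_continuousOn
    (hK.mono (prod_mono hIcc (subset_univ _)))
  -- slices are continuous
  have hslice : ∀ t ∈ S, Continuous (K t) := fun t ht =>
    continuous_slice_of_continuousOn_prod_univ hK ht
  refine continuousAt_of_dominated (bound := fun x => |ψ x| * |B|) ?_ ?_
    ((hψ.abs.mul continuous_const).integrable_of_hasCompactSupport (hψc.norm.mul_right)) ?_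
  · filter_upwards [hS.mem_nhds ht₀] with t ht
    exact (hψ.mul (hslice t ht)).aestronglyMeasurable
  · filter_upwards [hnhds] with t ht
    refine Eventually.of_forall fun x => ?_
    by_cases hx : x ∈ tsupport ψ
    · rw [Real.norm_eq_abs, abs_mul]
      refine mul_le_mul_of_nonneg_left ?_ (abs_nonneg _)
      have h := hB (t, x) ⟨⟨ht.1.le, ht.2.le⟩, hx⟩
      rw [Real.norm_eq_abs] at h
      exact h.trans (le_abs_self B)
    · have h0 : ψ x = 0 := image_eq_zero_of_notMem_tsupport hx
      rw [h0, zero_mul, norm_zero, abs_zero, zero_mul]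
  · refine Eventually.of_forall fun x => ?_
    have hc : ContinuousWithinAt (fun t => K t x) S t₀ :=
      (hK.comp (continuous_id.prodMk continuous_const).continuousOn
        (fun t ht => mk_mem_prod ht (mem_univ x))) t₀ ht₀
    exact continuousAt_const.mul (hc.continuousAt (hS.mem_nhds ht₀))

/-- **Identification of the pointwise limit with its smooth representative, everywhere** (module
docstring). [folklore] -/
theorem pointwiseLimit_eq_representative (hC₀ : 0 ≤ C₀) (hA : Tendsto A atTop atBot)
    (hw : ∀ k, IsSmoothSpaceTimeOn (Ico (A k) 0) (w k))
    (hdiv : ∀ k, ∀ t ∈ Ico (A k) 0, VectorCalculus.IsDivFree (w k t))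
    (hI : ∀ k, ∀ t ∈ Ioo (A k) 0, ∀ x, ‖w k t x‖ ≤ C₀ / Real.sqrt (-t))
    (hg : ∀ k, IsAdaptedBackwardKernel 1 (w k) (Ico (A k) 0) 0 0 (g k)) (hC₁ : 0 < C₁)
    (hC₂ : 0 < C₂)
    (hgb : ∀ k, ∀ t ∈ Ico (A k) 0, ∀ x, g k t x ≤ C₁ * ((0:ℝ) - t) ^ (-(3:ℝ) / 2) *
      Real.exp (-(‖x - (0 : ℝ³)‖ ^ 2) / (C₂ * ((0:ℝ) - t))))
    (hgK : ∀ t < 0, ∀ x, Tendsto (fun k => g k t x) atTop (𝓝 (Glim t x)))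
    (hmod : ∀ t < 0, ∀ x, ∀ ε : ℝ, 0 < ε → ∃ δ : ℝ, 0 < δ ∧
      ∀ᶠ j in atTop, ∀ y : ℝ³, ‖y - x‖ ≤ δ → |g j t y - g j t x| ≤ ε)
    {a : ℝ} {K : ℝ → ℝ³ → ℝ} (hKs : IsSmoothSpaceTimeOn (Ioo a 0) K)
    (hae : ∀ᵐ p : ℝ × ℝ³, p ∈ Ioo a 0 ×ˢ univ → Glim p.1 p.2 = K p.1 p.2) :
    ∀ t ∈ Ioo a 0, ∀ x, Glim t x = K t x := by
  have hGc : ∀ t < 0, Continuous (Glim t) := fun t ht => continuous_pointwiseLimit_slice hgK hmod ht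
  have hKc : ContinuousOn (uncurry K) (Ioo a 0 ×ˢ univ) := hKs.continuousOn
  have hKslice : ∀ t ∈ Ioo a 0, Continuous (K t) := fun t ht =>
    continuous_slice_of_continuousOn_prod_univ hKc ht
  -- Step 1: pairings with smooth compactly supported `ψ` agree for every `t ∈ (a, 0)`
  have hpair : ∀ ψ : ℝ³ → ℝ, ContDiff ℝ ∞ ψ → HasCompactSupport ψ →
      ∀ t ∈ Ioo a 0, ∫ x, ψ x * Glim t x = ∫ x, ψ x * K t x := by
    intro ψ hψ hψc
    -- both pairings are continuous on `(a, 0)`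
    have hP : ContinuousOn (fun t => ∫ x, ψ x * Glim t x) (Ioo a 0) := by
      intro t₀ ht₀
      refine ContinuousAt.continuousWithinAt ?_
      obtain ⟨L, hL⟩ := pairing_pointwiseLimit_lipschitz hC₀ hA hw hdiv hI hg hC₁ hC₂ hgb hgK hψ hψc
        (t₁ := t₀ - 1) (t₂ := t₀ / 2) (by linarith [ht₀.2])
      rw [Metric.continuousAt_iff]
      intro ε hε
      set L' : ℝ := max L 1 with hL'
      have hL'0 : 0 < L' := lt_of_lt_of_le one_pos (le_max_right _ _)
      refine ⟨min (ε / L') (min 1 (-t₀ / 2)), lt_min (div_pos hε hL'0)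
        (lt_min one_pos (by linarith [ht₀.2])), fun t ht => ?_⟩
      have ht' : |t - t₀| < min (ε / L') (min 1 (-t₀ / 2)) := by rwa [Real.dist_eq] at ht
      have h1 : |t - t₀| < 1 := lt_of_lt_of_le ht' ((min_le_right _ _).trans (min_le_left _ _))
      have h2 : |t - t₀| < -t₀ / 2 := lt_of_lt_of_le ht' ((min_le_right _ _).trans (min_le_right _ _))
      have h3 : |t - t₀| < ε / L' := lt_of_lt_of_le ht' (min_le_left _ _)
      rw [abs_lt] at h1 h2
      have htI : t ∈ Icc (t₀ - 1) (t₀ / 2) := ⟨by linarith, by linarith⟩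
      have ht₀I : t₀ ∈ Icc (t₀ - 1) (t₀ / 2) := ⟨by linarith, by linarith [ht₀.2]⟩
      rw [Real.dist_eq]
      calc |(∫ x, ψ x * Glim t x) - ∫ x, ψ x * Glim t₀ x| ≤ L * |t - t₀| := hL t₀ ht₀I t htI
        _ ≤ L' * |t - t₀| := mul_le_mul_of_nonneg_right (le_max_left _ _) (abs_nonneg _)
        _ < L' * (ε / L') := mul_lt_mul_of_pos_left h3 hL'0
        _ = ε := by field_simp
    have hQ : ContinuousOn (fun t => ∫ x, ψ x * K t x) (Ioo a 0) :=
      continuousOn_pairing_of_continuousOn isOpen_Ioo hKc hψ.continuous hψc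
    -- they agree for a.e. `t` (Fubini on the null set)
    have hae' : ∀ᵐ t : ℝ, t ∈ Ioo a 0 → (∫ x, ψ x * Glim t x) = ∫ x, ψ x * K t x := by
      have h := Measure.ae_ae_of_ae_prod (μ := (volume : Measure ℝ)) (ν := (volume : Measure ℝ³))
        (p := fun z : ℝ × ℝ³ => z ∈ Ioo a 0 ×ˢ univ → Glim z.1 z.2 = K z.1 z.2) hae
      filter_upwards [h] with t ht htI
      refine integral_congr_ae ?_
      filter_upwards [ht] with x hx
      rw [hx ⟨htI, mem_univ x⟩]
    have hres : (fun t => ∫ x, ψ x * Glim t x) =ᵐ[volume.restrict (Ioo a 0)]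
        fun t => ∫ x, ψ x * K t x := by
      rw [EventuallyEq, ae_restrict_iff' measurableSet_Ioo]
      exact hae'
    exact Measure.eqOn_open_of_ae_eq hres isOpen_Ioo hP hQ
  -- Step 2: identification of the values with a concentrated bump
  intro t ht x₀
  have ht0 : t < 0 := ht.2
  by_contra hne
  have hpos : 0 < |Glim t x₀ - K t x₀| := abs_pos.2 (sub_ne_zero.2 hne)
  set η : ℝ := |Glim t x₀ - K t x₀| / 3 with hη
  have hη0 : 0 < η := by positivity
  -- radii of `η`-continuity of both slices at `x₀`
  obtain ⟨δ₁, hδ₁, h₁⟩ := Metric.continuousAt_iff.1 (hGc t ht0).continuousAt η hη0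
  obtain ⟨δ₂, hδ₂, h₂⟩ := Metric.continuousAt_iff.1 (hKslice t ht).continuousAt η hη0
  set r : ℝ := min δ₁ δ₂ / 2 with hr
  have hr0 : 0 < r := by positivity
  have hrδ₁ : r < δ₁ := by
    have := min_le_left δ₁ δ₂; rw [hr]; linarith
  have hrδ₂ : r < δ₂ := by
    have := min_le_right δ₁ δ₂; rw [hr]; linarith
  let ψb : ContDiffBump x₀ := ⟨r / 2, r, by positivity, by linarith⟩
  set ψ : ℝ³ → ℝ := ⇑ψb with hψdef
  have hψs : ContDiff ℝ ∞ ψ := ψb.contDiff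
  have hψcs : HasCompactSupport ψ := ψb.hasCompactSupport
  have hψ0 : ∀ y, 0 ≤ ψ y := fun y => ψb.nonneg
  have hψsupp : ∀ y, ψ y ≠ 0 → ‖y - x₀‖ < r := by
    intro y hy
    have : y ∈ support ψ := hy
    rw [hψdef, ψb.support_eq] at this
    simpa [dist_eq_norm] using this
  have hIpos : 0 < ∫ y, ψ y := ψb.integral_pos
  -- the two `η ∫ψ` estimates
  have hG : |(∫ y, ψ y * Glim t y) - Glim t x₀ * ∫ y, ψ y| ≤ η * ∫ y, ψ y :=
    kernelLimit_abs_integral_mul_sub_le hψs.continuous hψcs hψ0 (hGc t ht0) fun y hy => by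
      have := h₁ (by rw [dist_eq_norm]; exact (hψsupp y hy).trans hrδ₁)
      rw [Real.dist_eq] at this
      exact this.le
  have hK' : |(∫ y, ψ y * K t y) - K t x₀ * ∫ y, ψ y| ≤ η * ∫ y, ψ y :=
    kernelLimit_abs_integral_mul_sub_le hψs.continuous hψcs hψ0 (hKslice t ht) fun y hy => by
      have := h₂ (by rw [dist_eq_norm]; exact (hψsupp y hy).trans hrδ₂)
      rw [Real.dist_eq] at this
      exact this.le
  have heq := hpair ψ hψs hψcs t ht
  -- conclude `3η ∫ψ = |Glim − K| ∫ψ ≤ 2η ∫ψ`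
  have key : |Glim t x₀ - K t x₀| * (∫ y, ψ y) ≤ 2 * η * ∫ y, ψ y := by
    have e : (Glim t x₀ - K t x₀) * (∫ y, ψ y) =
        ((Glim t x₀ * ∫ y, ψ y) - ∫ y, ψ y * Glim t y) +
          ((∫ y, ψ y * K t y) - K t x₀ * ∫ y, ψ y) := by
      linear_combination heq
    rw [← abs_of_pos hIpos, ← abs_mul, e]
    refine (abs_add_le _ _).trans ?_
    rw [abs_sub_comm] at hG
    have hI : |∫ y, ψ y| = ∫ y, ψ y := abs_of_pos hIpos
    rw [hI]
    linarith
  have h3 : |Glim t x₀ - K t x₀| ≤ 2 * η := le_of_mul_le_mul_right key hIpos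
  have h4 : |Glim t x₀ - K t x₀| = 3 * η := by rw [hη]; ring
  linarith

end Identify

/-! ### Hypothesis (B) of `tangentFlowTransfer_of_hyp` -/

/-- Locally uniform convergence gives pointwise convergence. [folklore] -/
theorem tendsto_at_of_tendstoLocallyUniformly {X Y : Type*} [TopologicalSpace X] [UniformSpace Y]
    {ι : Type*} {p : Filter ι} {F : ι → X → Y} {f : X → Y} (h : TendstoLocallyUniformly F f p)
    (x : X) : Tendsto (fun n => F n x) p (𝓝 (f x)) :=
  (tendstoLocallyUniformlyOn_univ.2 h).tendsto_at (mem_univ x)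

/-- **Kernel stability (hypothesis (B) of `tangentFlowTransfer_of_hyp`), proved.** Along a
blow-up sequence of classical unit-viscosity flows on windows `[A_k, 0)`, `A_k → −∞`, Type I with
one constant, Oseen-mild, with adapted kernels `g_k` under two-sided Gaussian bounds with fixed
constants, converging slice-wise locally uniformly (with two derivatives) to a Type-I ancient
mild `W`: a subsequence of the kernels converges pointwise to a jointly `C²` (indeed smooth)
classical solution `K` of `∂ₜK + W·∇K + ΔK = 0` on `(−∞, 0) × ℝ³`. Proof: pointwise extraction
(`exists_pointwise_limit_of_adaptedKernels`), very weak limit equation and hypoelliptic smoothing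
(`exists_smooth_representative`), identification everywhere (`pointwiseLimit_eq_representative`).
[folklore] -/
theorem kernelStability :
    ∀ (C₀ c₁ c₂ C₁ C₂ : ℝ) (A : ℕ → ℝ) (w : ℕ → ℝ → ℝ³ → ℝ³) (pw : ℕ → ℝ → ℝ³ → ℝ)
        (g : ℕ → ℝ → ℝ³ → ℝ) (W : ℝ → ℝ³ → ℝ³),
      0 ≤ C₀ → 0 < c₁ → 0 < c₂ → 0 < C₁ → 0 < C₂ → Tendsto A atTop atBot →
      (∀ k, IsClassicalNSSolutionOn (Ico (A k) 0) 1 0 (w k) (pw k)) →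
      (∀ k, ∀ t ∈ Ioo (A k) 0, ∀ x, ‖w k t x‖ ≤ C₀ / Real.sqrt (-t)) →
      (∀ k, ∀ s t : ℝ, A k < s → s < t → t < 0 → ∀ x,
        w k t x = UnboundedOperators.heatExtension (w k s) (t - s) x -
          oseenDuhamel 1 s (w k) (w k) t x) →
      (∀ k, IsAdaptedBackwardKernel 1 (w k) (Ico (A k) 0) 0 0 (g k)) →
      (∀ k, ∀ t ∈ Ico (A k) 0, ∀ x,
        c₁ * ((0:ℝ) - t) ^ (-(3:ℝ) / 2) * Real.exp (-(‖x - (0 : ℝ³)‖ ^ 2) / (c₂ * ((0:ℝ) - t))) ≤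
            g k t x ∧
          g k t x ≤ C₁ * ((0:ℝ) - t) ^ (-(3:ℝ) / 2) *
            Real.exp (-(‖x - (0 : ℝ³)‖ ^ 2) / (C₂ * ((0:ℝ) - t)))) →
      IsTypeIAncientMild C₀ W →
      (∀ t < 0, TendstoLocallyUniformly (fun k => w k t) (W t) atTop) →
      (∀ t < 0, TendstoLocallyUniformly (fun k => fderiv ℝ (w k t)) (fderiv ℝ (W t)) atTop) →
      (∀ t < 0, TendstoLocallyUniformly (fun k => fderiv ℝ (fderiv ℝ (w k t)))
        (fderiv ℝ (fderiv ℝ (W t))) atTop) →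
      ∃ ψ : ℕ → ℕ, StrictMono ψ ∧ ∃ K : ℝ → ℝ³ → ℝ,
        ContDiffOn ℝ 2 (uncurry K) (Iio 0 ×ˢ univ) ∧
        (∀ t ∈ Iio (0:ℝ), ∀ x,
          timeDerivWithin (Iio 0) K t x + fderiv ℝ (K t) x (W t x) + 1 * (Δ (K t)) x = 0) ∧
        (∀ t < 0, ∀ x, Tendsto (fun j => g (ψ j) t x) atTop (𝓝 (K t x))) := by
  intro C₀ c₁ c₂ C₁ C₂ A w pw g W hC₀ _ _ hC₁ hC₂ hA hcl hI _ hg hgb hW hW0 _ _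
  have hw : ∀ k, IsSmoothSpaceTimeOn (Ico (A k) 0) (w k) := fun k => (hcl k).smooth_velocity
  have hdiv : ∀ k, ∀ t ∈ Ico (A k) 0, VectorCalculus.IsDivFree (w k t) := fun k => (hcl k).divFree
  have hgb' : ∀ k, ∀ t ∈ Ico (A k) 0, ∀ x, g k t x ≤ C₁ * ((0:ℝ) - t) ^ (-(3:ℝ) / 2) *
      Real.exp (-(‖x - (0 : ℝ³)‖ ^ 2) / (C₂ * ((0:ℝ) - t))) := fun k t ht x => (hgb k t ht x).2
  -- pointwise extraction
  obtain ⟨φ, hφ, Glim, hconv, hmod⟩ :=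
    exists_pointwise_limit_of_adaptedKernels hC₀ hA hw hdiv hI hg hC₁ hC₂ hgb'
  -- data along the subsequence
  have hφt : Tendsto φ atTop atTop := hφ.tendsto_atTop
  have hA' : Tendsto (fun j => A (φ j)) atTop atBot := hA.comp hφt
  have hwW : ∀ t < 0, ∀ x, Tendsto (fun j => w (φ j) t x) atTop (𝓝 (W t x)) := fun t ht x =>
    (tendsto_at_of_tendstoLocallyUniformly (hW0 t ht) x).comp hφt
  have hWs : IsSmoothSpaceTimeOn (Iio 0) W := hW.contDiffOn
  have hWdiv : ∀ t < 0, VectorCalculus.IsDivFree (W t) := fun t ht => hW.isDivFree ht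
  -- on each slab `(t - 1, 0)`, `Glim` is a smooth solution
  have hslab : ∀ a < 0, IsSmoothSpaceTimeOn (Ioo a 0) Glim ∧ ∀ t ∈ Ioo a 0, ∀ x,
      deriv (fun s => Glim s x) t + fderiv ℝ (Glim t) x (W t x) + 1 * (Δ (Glim t)) x = 0 := by
    intro a ha
    obtain ⟨K, hKs, hae, hKeq⟩ := exists_smooth_representative (A := fun j => A (φ j))
      (w := fun j => w (φ j)) (g := fun j => g (φ j)) hC₀ hA' (fun j => hw _) (fun j => hdiv _)
      (fun j => hI _) (fun j => hg _) hC₁ hC₂ (fun j => hgb' _) hWs hWdiv hwW hconv ha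
    have hid := pointwiseLimit_eq_representative (A := fun j => A (φ j)) (w := fun j => w (φ j))
      (g := fun j => g (φ j)) hC₀ hA' (fun j => hw _) (fun j => hdiv _) (fun j => hI _)
      (fun j => hg _) hC₁ hC₂ (fun j => hgb' _) hconv hmod hKs hae
    have hEq : EqOn (uncurry Glim) (uncurry K) (Ioo a 0 ×ˢ univ) := by
      rintro ⟨t, x⟩ ⟨ht, -⟩
      exact hid t ht x
    refine ⟨hKs.congr hEq, fun t ht x => ?_⟩
    have e1 : deriv (fun s => Glim s x) t = deriv (fun s => K s x) t := by
      refine Filter.EventuallyEq.deriv_eq ?_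
      filter_upwards [isOpen_Ioo.mem_nhds ht] with s hs
      exact hid s hs x
    have e2 : Glim t = K t := funext fun y => hid t ht y
    rw [e1, e2]
    exact hKeq t ht x
  refine ⟨φ, hφ, Glim, ?_, fun t ht x => ?_, hconv⟩
  · -- joint `C²` on `(−∞, 0) × ℝ³`, locally from the slabs
    refine ContDiffOn.of_le (n := ∞) ?_ (by norm_cast)
    intro p hp
    have ht : p.1 < 0 := hp.1
    have h := (hslab (p.1 - 1) (by linarith)).1
    exact (h.contDiffAt isOpen_Ioo ⟨by linarith, ht⟩ p.2).contDiffWithinAt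
  · -- the equation, with the one-sided time derivative on the open set `(−∞, 0)`
    have ht0 : t < 0 := ht
    rw [timeDerivWithin_eq_deriv isOpen_Iio ht Glim x]
    exact (hslab (t - 1) (by linarith)).2 t ⟨by linarith, ht0⟩ x

end Summit.NavierStokesRegularity.NavierStokesRegularity.Theorems

end
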